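import Literature.MathematicalPhysics.QuantumLattice.HubbardNNNHoppingPlaquetteFlux
import Literature.MathematicalPhysics.QuantumLattice.HubbardNNNHoppingThermodynamicLimit
import Literature.MathematicalPhysics.QuantumLattice.HubbardNNNHoppingWindowCertificate
import Literature.MathematicalPhysics.QuantumLattice.MagneticHubbardTorusPeierls
import Mathlib.Topology.Order.LiminfLimsup
import HarnessLib

/-!
# The `t–t'` Hubbard torus in a uniform orbital field: a priori bounds, the flux-`p/q` progression
# of tori, its lower / upper thermodynamic energy densities, and the passage of certified windows

Topic `Literature/MathematicalPhysics/QuantumLattice` (namespace = path; family `hubbard`). Companion of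
`HubbardNNNHoppingPlaquetteFlux.lean` (`hubbardTorusTT'Plaquette L t' U m`: the `t–t'–U` torus with flux
`2πm/L` through every plaquette, Landau gauge; sector energy `plaquetteFluxEnergyTT' L t' U δ m` at
`N = 2⌊(1−δ)L²/2⌋`, `S^z = 0`; time reversal `E(−m) = E(m)`) and of
`HubbardNNNHoppingThermodynamicLimit.lean` (Ruelle's thermodynamic-limit energy density
`energyDensityTT' t t' U n` of the field-free `t–t'` model with its window-passage lemmas). It is the
thermodynamic-limit PASSAGE layer («FL4») of the Hubbard cuprate cell's row class T6 «certified
orbital-flux energy cost» (`hubbard-cq`, card `orbital-flux-condensation-cost`): the row compares the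
energy density at FIXED flux `Φ = 2πp/q` per plaquette with the field-free one, along the tori of side
`L = q(k+1)` carrying `m = p(k+1)` flux quanta (plaquette holonomy `e^{2πi p/q}` on every one of them,
`coe_u1Plaquette_landauGauge_progression`).

## Contents (everything PROVED; the three `def`s are the only new objects)

* §1 A PRIORI BOUNDS (stability, Ruelle §2.2): every unit vector has
  `|Re⟨φ, H_m φ⟩| ≤ (8 + 8|t'| + |U|)·L²` (`abs_re_star_dotProduct_hubbardTorusTT'Plaquette_mulVec_le`:
  `4L²` unit-modulus nearest-neighbour Peierls bond pairs, `4L²` diagonal ones, `L²` doubly-occupied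
  sites), hence `|plaquetteFluxEnergyTT' L t' U δ m| ≤ (8 + 8|t'| + |U|)·L²` in every sector
  (`abs_plaquetteFluxEnergyTT'_le`; the generic step `abs_minEnergyOn_le_of_forall_abs_re_le`).
* §2 THE PROGRESSION: `plaquetteFluxEnergyPerSite t' U δ p q k = E_{q(k+1)}(p(k+1)) / (q(k+1))²` and its
  `liminf` / `limsup` along `k → ∞`, `plaquetteFluxEnergyDensityInf / …Sup t' U δ p q` — the LOWER and
  UPPER thermodynamic energy densities at flux `2πp/q`; bounded by §1, `Inf ≤ Sup`, even in `p`
  (Byers–Yang, from `plaquetteFluxEnergyTT'_neg`).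
* §3 WINDOW PASSAGE (the row grammar of the cell, `∀ L ≥ L₀, q ∣ L`): certified floors
  `lo·L² ≤ E_L(p·L/q)` give `lo ≤ Inf`, certified caps give `Sup ≤ hi`.
* §4 ZERO FLUX: at `p = 0` the progression is a subsequence of the field-free canonical energies per
  site, so `Inf = Sup = energyDensityTT' 1 t' U (1−δ)` (`U ≥ 0`, `−1 < δ ≤ 1`; the `SU(2)` sector
  reduction `groundEnergy_hubbardTorusTT'_eq_minEnergyOn_szSector` and `tendsto_energyDensityTT'_torus`).
* §5 THE T6 WORD TYPED: a flux-row floor `lo` and a field-free thermodynamic cap `e(0) ≤ hi` with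
  `c ≤ lo − hi` give the orbital-flux energy cost floor in the eventual finite-volume form
  `(e(0) + c)·L² ≤ E_L(p·L/q)` for all large `L`, `q ∣ L` (`orbitalFluxCost_floor_of_rows`) and in the
  thermodynamic form `c ≤ Inf(p/q) − e(0)` (`le_plaquetteFluxEnergyDensityInf_sub_energyDensityTT'_of_rows`;
  `c = K·(2πp/q)²` is the card's «orbital rigidity `K` at flux `2πp/q`»,
  `orbitalRigidity_of_rows`); ceiling twin `Sup(p/q) − e(0) ≤ hi − lo`.

HONEST SCOPE. The EXISTENCE of `lim_k E_{q(k+1)}(p(k+1))/(q(k+1))²` for `p ≠ 0` (periodisation over the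
magnetic translations of the `q × 1` supercell) is NOT proved here and NOT used: the row's floor is a
statement about every large torus of the progression, which is exactly what `Inf` records; should the
limit be proved, `Inf = Sup = lim` by `Tendsto.liminf_eq`. EXISTENCE HALF PARKED (sizing of record, cell
`hubbard-cq` 2026-08-27): the model-free periodisation theorem `exists_tendsto_groundEnergy_div_pow` does
not apply verbatim — the Landau gauge is only `q`-periodic in `x₁`, so `H_m` is periodised over the
MAGNETIC translations (`HubbardNNNHoppingPlaquetteFluxTranslation.lean`), not the lattice ones — and the
canonical route is a Fekete / tiling programme along `q ∣ L` for RECTANGULAR flux tori with gauge-rotated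
major cuts (the field-free chain `HubbardNNNHoppingCut` → `…Tiling` → `…ThermodynamicLimit` redone with
Peierls phases, ≈ 1500 lines); it is deliberately not undertaken while the row has no certified producer
(finite-`L` flux words need no thermodynamic limit). No number, no flux table, nothing about
superconductivity (a positive cost at fixed flux is a finite energy word, not an order parameter).

## References
* D. Ruelle, *Statistical Mechanics: Rigorous Results* (Benjamin, 1969), §2.2 (stability of finite-range
  lattice interactions), §3.3 (ground-state energy density; bounds valid in every large volume pass to
  the limit). [cite: Ruelle1969, §3.3]
* D. R. Hofstadter, Phys. Rev. B 14 (1976) 2239, §II (flux `2πp/q` per plaquette, magnetic cell `q × 1`).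
  [cite: Hofstadter1976, §II]
* N. Byers, C. N. Yang, PRL 7 (1961) 46 (`E(−Φ) = E(Φ)`). [cite: ByersYang1961]
* E. H. Lieb, PRL 62 (1989) 1201, proof of Thm. 1 (the `2n`-particle ground energy is attained at
  `S^z = 0`). [cite: LiebPRL1989, proof of Theorem 1]
-/

noncomputable section

namespace Literature.MathematicalPhysics.QuantumLattice

open _root_.Matrix Finset _root_.Filter Literature.MathematicalPhysics.QuantumFieldTheory HubbardWave0
  ThermodynamicLimit
open Literature.Barriers.QuantumFields (u1Plaquette)
open scoped _root_.Topology ComplexConjugate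

/-! ### §1 A priori bounds -/

section MinEnergy

variable {n : Type*} [Fintype n]

/-- **A uniform Rayleigh bound controls every sector energy**: if `|Re⟨ψ, Aψ⟩| ≤ C` for all unit
vectors `ψ` (`C ≥ 0`), then `|minEnergyOn A K| ≤ C` for every subspace `K` (for `K = ⊥` the sector energy
is the junk value `0`). Ruelle (1969) §2.2 (stability). [cite: Ruelle1969, §3.3] -/
theorem abs_minEnergyOn_le_of_forall_abs_re_le (A : Matrix n n ℂ) (K : Submodule ℂ (n → ℂ)) {C : ℝ}
    (hC : 0 ≤ C) (h : ∀ ψ : n → ℂ, star ψ ⬝ᵥ ψ = 1 → |(star ψ ⬝ᵥ A *ᵥ ψ).re| ≤ C) :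
    |A.minEnergyOn K| ≤ C := by
  unfold Matrix.minEnergyOn
  set S : Set ℝ := {E : ℝ | ∃ ψ ∈ K, star ψ ⬝ᵥ ψ = 1 ∧ E = (star ψ ⬝ᵥ A *ᵥ ψ).re} with hS
  by_cases hne : S.Nonempty
  · have hlow : ∀ E ∈ S, -C ≤ E := by
      rintro E ⟨ψ, -, h1, rfl⟩
      exact neg_le_of_abs_le (h ψ h1)
    have hbdd : BddBelow S := ⟨-C, hlow⟩
    rw [abs_le]
    refine ⟨le_csInf hne hlow, ?_⟩
    obtain ⟨E, hE⟩ := hne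
    refine (csInf_le hbdd hE).trans ?_
    obtain ⟨ψ, -, h1, rfl⟩ := hE
    exact le_of_abs_le (h ψ h1)
  · rw [Set.not_nonempty_iff_eq_empty.1 hne, Real.sInf_empty, abs_zero]
    exact hC

end MinEnergy

section Bonds

variable {Λ : Type*} [LinearOrder Λ] [Fintype Λ]

/-- **One Peierls bond pair in a unit vector**: `|⟨φ, (a·c†_p c_q + conj a · c†_q c_p) φ⟩| ≤ 2‖a‖`
(`|⟨φ, c†_p c_q φ⟩| ≤ 1` from `‖c(f)‖ = ‖f‖`, `norm_star_dotProduct_creation_mul_annihilation_mulVec_le`).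
Bratteli–Robinson II, Prop. 5.2.2. [cite: BratteliRobinsonII1997, Prop. 5.2.2] -/
theorem norm_star_dotProduct_peierlsPair_mulVec_le {φ : Fock Λ} (hφ : star φ ⬝ᵥ φ = 1) (a : ℂ)
    (p q : Λ) :
    ‖star φ ⬝ᵥ ((a • (creation p * annihilation q) + conj a • (creation q * annihilation p)) *ᵥ φ)‖ ≤
      2 * ‖a‖ := by
  rw [add_mulVec, smul_mulVec, smul_mulVec, dotProduct_add, dotProduct_smul, dotProduct_smul,
    smul_eq_mul, smul_eq_mul]
  refine (norm_add_le _ _).trans ?_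
  rw [norm_mul, norm_mul, Complex.norm_conj, two_mul]
  exact add_le_add
    (mul_le_of_le_one_right (norm_nonneg _)
      (norm_star_dotProduct_creation_mul_annihilation_mulVec_le hφ p q))
    (mul_le_of_le_one_right (norm_nonneg _)
      (norm_star_dotProduct_creation_mul_annihilation_mulVec_le hφ q p))

end Bonds

section Helpers

/-- Triple sums of uniformly bounded terms. [folklore] -/
private theorem abs_sum₃_le {α β γ : Type*} (s : Finset α) (t : Finset β) (u : Finset γ)
    {f : α → β → γ → ℝ} {C : ℝ} (h : ∀ a b c, |f a b c| ≤ C) :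
    |∑ a ∈ s, ∑ b ∈ t, ∑ c ∈ u, f a b c| ≤ (s.card : ℝ) * ((t.card : ℝ) * ((u.card : ℝ) * C)) := by
  have h3 : ∀ a b, |∑ c ∈ u, f a b c| ≤ (u.card : ℝ) * C := fun a b =>
    (Finset.abs_sum_le_sum_abs _ _).trans
      ((Finset.sum_le_sum fun c _ => h a b c).trans (by rw [Finset.sum_const, nsmul_eq_mul]))
  have h2 : ∀ a, |∑ b ∈ t, ∑ c ∈ u, f a b c| ≤ (t.card : ℝ) * ((u.card : ℝ) * C) := fun a =>
    (Finset.abs_sum_le_sum_abs _ _).trans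
      ((Finset.sum_le_sum fun b _ => h3 a b).trans (by rw [Finset.sum_const, nsmul_eq_mul]))
  exact (Finset.abs_sum_le_sum_abs _ _).trans
    ((Finset.sum_le_sum fun a _ => h2 a).trans (by rw [Finset.sum_const, nsmul_eq_mul]))

/-- `k ≤ q(k+1)` for `q ≥ 1`. [folklore] -/
private theorem le_side {q : ℕ} (hq : 0 < q) (k : ℕ) : k ≤ q * (k + 1) :=
  k.le_succ.trans (Nat.le_mul_of_pos_left _ hq)

end Helpers

section FluxTorus

variable (L : ℕ) [NeZero L]

/-- `|(ℤ/L)²| = L²` (as a real number). [folklore] -/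
private theorem card_site_two_real : (Fintype.card (Site 2 L) : ℝ) = (L : ℝ) ^ 2 := by
  rw [Fintype.card_fun, ZMod.card, Fintype.card_fin]; push_cast; ring

omit [NeZero L] in
/-- `|FermionTorus 2 L| = L²`. [folklore] -/
private theorem card_fermionTorus_two_flux : Fintype.card (FermionTorus 2 L) = L ^ 2 := by
  simp [FermionTorus]

/-- **The Peierls nearest-neighbour torus in a unit vector**: `|Re⟨φ, H_A(1,U) φ⟩| ≤ (8 + |U|)·L²` for
EVERY lattice gauge field `A` (`4L²` unit-modulus bond pairs, each `≤ 2`; `L²` doubly-occupied sites,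
each in `[0,1]`). Ruelle (1969) §2.2. [cite: Ruelle1969, §3.3] -/
theorem abs_re_star_dotProduct_magneticHubbardTorus_mulVec_le (A : GaugeConfig 2 L Circle) (U : ℝ)
    {φ : Fock (Orb (FermionTorus 2 L))} (hφ : star φ ⬝ᵥ φ = 1) :
    |(star φ ⬝ᵥ (magneticHubbardTorus L A 1 U *ᵥ φ)).re| ≤ (8 + |U|) * (L : ℝ) ^ 2 := by
  rw [magneticHubbardTorus_one, add_mulVec, neg_mulVec, dotProduct_add, dotProduct_neg, Complex.add_re,
    Complex.neg_re]
  -- the hopping part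
  have hhop : |(star φ ⬝ᵥ ((∑ x : Site 2 L, ∑ i : Fin 2, ∑ σ : Fin 2,
      (((A (x, i) : Circle) : ℂ) •
          (creation (orb (FermionTorus.ofTorusSite (Site.shift x i)) σ) *
            annihilation (orb (FermionTorus.ofTorusSite x) σ)) +
        (starRingEnd ℂ) ((A (x, i) : Circle) : ℂ) •
          (creation (orb (FermionTorus.ofTorusSite x) σ) *
            annihilation (orb (FermionTorus.ofTorusSite (Site.shift x i)) σ)))) *ᵥ φ)).re| ≤
      8 * (L : ℝ) ^ 2 := by
    simp only [sum_mulVec, dotProduct_sum, Complex.re_sum]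
    have hT : ∀ (x : Site 2 L) (i σ : Fin 2),
        |(star φ ⬝ᵥ ((((A (x, i) : Circle) : ℂ) •
            (creation (orb (FermionTorus.ofTorusSite (Site.shift x i)) σ) *
              annihilation (orb (FermionTorus.ofTorusSite x) σ)) +
          (starRingEnd ℂ) ((A (x, i) : Circle) : ℂ) •
            (creation (orb (FermionTorus.ofTorusSite x) σ) *
              annihilation (orb (FermionTorus.ofTorusSite (Site.shift x i)) σ))) *ᵥ φ)).re| ≤ 2 := by
      intro x i σ
      refine (Complex.abs_re_le_norm _).trans ?_
      refine (norm_star_dotProduct_peierlsPair_mulVec_le hφ _ _ _).trans ?_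
      rw [Circle.norm_coe, mul_one]
    refine (abs_sum₃_le _ _ _ hT).trans (le_of_eq ?_)
    simp only [Finset.card_univ, Fintype.card_fin, Nat.cast_ofNat]
    rw [card_site_two_real]; ring
  -- the interaction part
  have hint : |(star φ ⬝ᵥ ((((U : ℝ) : ℂ) • ∑ y : FermionTorus 2 L, numberOp y 0 * numberOp y 1) *ᵥ φ)).re| ≤
      |U| * (L : ℝ) ^ 2 := by
    rw [smul_mulVec, dotProduct_smul, smul_eq_mul, Complex.re_ofReal_mul, abs_mul]
    refine mul_le_mul_of_nonneg_left ?_ (abs_nonneg U)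
    simp only [sum_mulVec, dotProduct_sum, Complex.re_sum]
    refine (Finset.abs_sum_le_sum_abs _ _).trans ?_
    have h1 : ∀ y : FermionTorus 2 L,
        |(star φ ⬝ᵥ ((numberOp y 0 * numberOp y 1) *ᵥ φ)).re| ≤ 1 := by
      intro y
      rw [← mulVec_mulVec, abs_of_nonneg (re_dotProduct_numberOp_numberOp_nonneg φ y)]
      exact (re_dotProduct_numberOp_numberOp_le φ y).trans (by rw [hφ, Complex.one_re])
    refine (Finset.sum_le_sum fun y _ => h1 y).trans ?_
    rw [Finset.sum_const, Finset.card_univ, nsmul_eq_mul, mul_one, card_fermionTorus_two_flux]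
    push_cast
    exact le_rfl
  refine (abs_add_le _ _).trans ?_
  rw [abs_neg]
  have hsum := add_le_add hhop hint
  linarith

/-- **A diagonal Peierls bond sum in a unit vector**: `|Re⟨φ, D_a φ⟩| ≤ 8·L²` whenever every amplitude
has `‖a_s(x)‖ ≤ 1` (`4L²` bond pairs, each `≤ 2`). Ruelle (1969) §2.2. [cite: Ruelle1969, §3.3] -/
theorem abs_re_star_dotProduct_diagPeierlsHopping_mulVec_le (a : Fin 2 → Site 2 L → ℂ)
    (ha : ∀ s x, ‖a s x‖ ≤ 1) {φ : Fock (Orb (FermionTorus 2 L))} (hφ : star φ ⬝ᵥ φ = 1) :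
    |(star φ ⬝ᵥ (diagPeierlsHopping L a *ᵥ φ)).re| ≤ 8 * (L : ℝ) ^ 2 := by
  unfold diagPeierlsHopping
  simp only [sum_mulVec, dotProduct_sum, Complex.re_sum]
  have hT : ∀ (s : Fin 2) (x : Site 2 L) (σ : Fin 2),
      |(star φ ⬝ᵥ ((a s x • (creation (orb (FermionTorus.ofTorusSite (x + torusDiagJump L s)) σ) *
            annihilation (orb (FermionTorus.ofTorusSite x) σ)) +
          conj (a s x) • (creation (orb (FermionTorus.ofTorusSite x) σ) *
            annihilation (orb (FermionTorus.ofTorusSite (x + torusDiagJump L s)) σ))) *ᵥ φ)).re| ≤ 2 := by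
    intro s x σ
    refine (Complex.abs_re_le_norm _).trans ?_
    refine (norm_star_dotProduct_peierlsPair_mulVec_le hφ _ _ _).trans ?_
    have := ha s x
    linarith
  refine (abs_sum₃_le _ _ _ hT).trans (le_of_eq ?_)
  simp only [Finset.card_univ, Fintype.card_fin, Nat.cast_ofNat]
  rw [card_site_two_real]; ring

/-- The Landau-gauge diagonal amplitudes are phases: `‖landauDiagAmp L m s x‖ = 1`. [cite: Hofstadter1976, §II] -/
theorem norm_landauDiagAmp (m : ℤ) (s : Fin 2) (x : Site 2 L) : ‖landauDiagAmp L m s x‖ = 1 := by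
  by_cases hs : s = 0
  · subst hs; rw [landauDiagAmp_zero_apply, Circle.norm_coe]
  · obtain rfl : s = 1 := Fin.eq_one_of_ne_zero s hs
    rw [landauDiagAmp_one_apply, Circle.norm_coe]

/-- **The torus in the orbital field in a unit vector**:
`|Re⟨φ, hubbardTorusTT'Plaquette L t' U m φ⟩| ≤ (8 + 8|t'| + |U|)·L²`, uniformly in the flux `m`.
Ruelle (1969) §2.2. [cite: Ruelle1969, §3.3] -/
theorem abs_re_star_dotProduct_hubbardTorusTT'Plaquette_mulVec_le (t' U : ℝ) (m : ℤ)
    {φ : Fock (Orb (FermionTorus 2 L))} (hφ : star φ ⬝ᵥ φ = 1) :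
    |(star φ ⬝ᵥ (hubbardTorusTT'Plaquette L t' U m *ᵥ φ)).re| ≤ (8 + 8 * |t'| + |U|) * (L : ℝ) ^ 2 := by
  rw [hubbardTorusTT'Plaquette, add_mulVec, dotProduct_add, Complex.add_re, smul_mulVec, dotProduct_smul,
    smul_eq_mul, ← Complex.ofReal_neg, Complex.re_ofReal_mul]
  have h1 := abs_re_star_dotProduct_magneticHubbardTorus_mulVec_le L (landauGauge L m) U hφ
  have h2 := abs_re_star_dotProduct_diagPeierlsHopping_mulVec_le L (landauDiagAmp L m)
    (fun s x => (norm_landauDiagAmp L m s x).le) hφ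
  refine (abs_add_le _ _).trans ?_
  rw [abs_mul, abs_neg]
  have h3 := mul_le_mul_of_nonneg_left h2 (abs_nonneg t')
  linarith

/-- **A priori bound on the sector energies in the orbital field**:
`|plaquetteFluxEnergyTT' L t' U δ m| ≤ (8 + 8|t'| + |U|)·L²` for every `δ` and every flux `m` (stability;
the empty sector `δ < −1` carries the junk value `0`). Ruelle (1969) §2.2. [cite: Ruelle1969, §3.3] -/
theorem abs_plaquetteFluxEnergyTT'_le (t' U δ : ℝ) (m : ℤ) :
    |plaquetteFluxEnergyTT' L t' U δ m| ≤ (8 + 8 * |t'| + |U|) * (L : ℝ) ^ 2 := by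
  unfold plaquetteFluxEnergyTT'
  exact abs_minEnergyOn_le_of_forall_abs_re_le _ _ (by positivity)
    fun ψ hψ => abs_re_star_dotProduct_hubbardTorusTT'Plaquette_mulVec_le L t' U m hψ

/-- At zero flux the sector energy is the canonical `N_L = 2⌊(1−δ)L²/2⌋`-particle ground energy of the
field-free `t–t'` torus (`L ≥ 3`, `δ ≥ −1`; the `SU(2)` reduction `E(2n) = E(2n, S^z = 0)`, Lieb 1989).
[cite: LiebPRL1989, proof of Theorem 1] -/
theorem plaquetteFluxEnergyTT'_zero_eq_groundEnergy (hL : 3 ≤ L) (t' U : ℝ) {δ : ℝ} (hδ : -1 ≤ δ) :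
    plaquetteFluxEnergyTT' L t' U δ 0 = groundEnergy (hubbardTorusTT' L 1 t' U) (rectN (1 - δ) L) := by
  have hn : ⌊(1 - δ) * (L : ℝ) ^ 2 / 2⌋₊ ≤ Fintype.card (FermionTorus 2 L) := by
    rw [card_fermionTorus_two_flux]
    refine Nat.floor_le_of_le ?_
    push_cast
    nlinarith [sq_nonneg (L : ℝ)]
  rw [plaquetteFluxEnergyTT'_zero L hL, fluxEnergyTT'_eq, hubbardTorusTT'Flux_zero, rectN,
    groundEnergy_hubbardTorusTT'_eq_minEnergyOn_szSector L 1 t' U hn]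

end FluxTorus

/-! ### §2 The flux-`p/q` progression and its lower / upper thermodynamic energy densities -/

section Progression

variable (t' U δ : ℝ) (p : ℤ) (q : ℕ) [NeZero q]

/-- **The energy per site of the `k`-th torus of the flux-`p/q` progression**: side `L = q(k+1)`,
`m = p(k+1)` flux quanta, i.e. flux `2πp/q` through every plaquette:
`E_{q(k+1)}(t', U, δ; p(k+1)) / (q(k+1))²`. [cite: Hofstadter1976, §II] -/
def plaquetteFluxEnergyPerSite (k : ℕ) : ℝ :=
  plaquetteFluxEnergyTT' (q * (k + 1)) t' U δ (p * ((k + 1 : ℕ) : ℤ)) / (((q * (k + 1) : ℕ) : ℝ)) ^ 2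

/-- **The LOWER thermodynamic energy density at flux `2πp/q`**: `liminf_k` of the energies per site along
the progression (the limit is not claimed to exist; see the module docstring). [cite: Ruelle1969, §3.3] -/
def plaquetteFluxEnergyDensityInf : ℝ :=
  liminf (plaquetteFluxEnergyPerSite t' U δ p q) atTop

/-- **The UPPER thermodynamic energy density at flux `2πp/q`**: `limsup_k` of the energies per site along
the progression. [cite: Ruelle1969, §3.3] -/
def plaquetteFluxEnergyDensitySup : ℝ :=
  limsup (plaquetteFluxEnergyPerSite t' U δ p q) atTop

/-- Every torus of the progression carries the flux `2πp/q`: the plaquette holonomy is `exp(2πi p/q)`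
everywhere. [cite: Hofstadter1976, §II] -/
theorem coe_u1Plaquette_landauGauge_progression (k : ℕ) (x : Site 2 (q * (k + 1))) :
    (u1Plaquette (landauGauge (q * (k + 1)) (p * ((k + 1 : ℕ) : ℤ))) x : ℂ) =
      Complex.exp (2 * Real.pi * Complex.I * p / q) := by
  have hq : 0 < q := Nat.pos_of_ne_zero (NeZero.ne q)
  have h := coe_u1Plaquette_landauGauge_of_dvd (q * (k + 1)) p (NeZero.ne q) (dvd_mul_right _ _) x
  rwa [Nat.mul_div_cancel_left _ hq] at h

/-- The side of the `k`-th torus is positive (as a real number). [folklore] -/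
private theorem side_pos (k : ℕ) : (0 : ℝ) < ((q * (k + 1) : ℕ) : ℝ) := by
  have hq : 0 < q := Nat.pos_of_ne_zero (NeZero.ne q)
  exact_mod_cast Nat.mul_pos hq k.succ_pos

/-- **A priori bound along the progression**: `|E_k / L_k²| ≤ 8 + 8|t'| + |U|`. [cite: Ruelle1969, §3.3] -/
theorem abs_plaquetteFluxEnergyPerSite_le (k : ℕ) :
    |plaquetteFluxEnergyPerSite t' U δ p q k| ≤ 8 + 8 * |t'| + |U| := by
  unfold plaquetteFluxEnergyPerSite
  have hL : (0 : ℝ) < (((q * (k + 1) : ℕ) : ℝ)) ^ 2 := pow_pos (side_pos q k) 2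
  rw [abs_div, abs_of_pos hL, div_le_iff₀ hL]
  exact abs_plaquetteFluxEnergyTT'_le _ t' U δ _

/-- The energies per site are bounded above along the progression. [cite: Ruelle1969, §3.3] -/
theorem isBoundedUnder_le_plaquetteFluxEnergyPerSite :
    IsBoundedUnder (· ≤ ·) atTop (plaquetteFluxEnergyPerSite t' U δ p q) :=
  isBoundedUnder_of ⟨8 + 8 * |t'| + |U|, fun k => le_of_abs_le (abs_plaquetteFluxEnergyPerSite_le t' U δ p q k)⟩

/-- The energies per site are bounded below along the progression. [cite: Ruelle1969, §3.3] -/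
theorem isBoundedUnder_ge_plaquetteFluxEnergyPerSite :
    IsBoundedUnder (· ≥ ·) atTop (plaquetteFluxEnergyPerSite t' U δ p q) :=
  isBoundedUnder_of ⟨-(8 + 8 * |t'| + |U|), fun k =>
    neg_le_of_abs_le (abs_plaquetteFluxEnergyPerSite_le t' U δ p q k)⟩

/-- `Inf ≤ Sup`. [cite: Ruelle1969, §3.3] -/
theorem plaquetteFluxEnergyDensityInf_le_sup :
    plaquetteFluxEnergyDensityInf t' U δ p q ≤ plaquetteFluxEnergyDensitySup t' U δ p q :=
  liminf_le_limsup (isBoundedUnder_le_plaquetteFluxEnergyPerSite t' U δ p q)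
    (isBoundedUnder_ge_plaquetteFluxEnergyPerSite t' U δ p q)

/-- `|Inf| ≤ 8 + 8|t'| + |U|`. [cite: Ruelle1969, §3.3] -/
theorem abs_plaquetteFluxEnergyDensityInf_le :
    |plaquetteFluxEnergyDensityInf t' U δ p q| ≤ 8 + 8 * |t'| + |U| := by
  refine abs_le.2 ⟨?_, ?_⟩
  · exact le_liminf_of_le (isBoundedUnder_le_plaquetteFluxEnergyPerSite t' U δ p q).isCoboundedUnder_ge
      (Eventually.of_forall fun k => neg_le_of_abs_le (abs_plaquetteFluxEnergyPerSite_le t' U δ p q k))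
  · exact (plaquetteFluxEnergyDensityInf_le_sup t' U δ p q).trans
      (limsup_le_of_le (isBoundedUnder_ge_plaquetteFluxEnergyPerSite t' U δ p q).isCoboundedUnder_le
        (Eventually.of_forall fun k => le_of_abs_le (abs_plaquetteFluxEnergyPerSite_le t' U δ p q k)))

/-- `|Sup| ≤ 8 + 8|t'| + |U|`. [cite: Ruelle1969, §3.3] -/
theorem abs_plaquetteFluxEnergyDensitySup_le :
    |plaquetteFluxEnergyDensitySup t' U δ p q| ≤ 8 + 8 * |t'| + |U| := by
  refine abs_le.2 ⟨?_, ?_⟩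
  · exact (le_liminf_of_le (isBoundedUnder_le_plaquetteFluxEnergyPerSite t' U δ p q).isCoboundedUnder_ge
      (Eventually.of_forall fun k =>
        neg_le_of_abs_le (abs_plaquetteFluxEnergyPerSite_le t' U δ p q k))).trans
      (plaquetteFluxEnergyDensityInf_le_sup t' U δ p q)
  · exact limsup_le_of_le (isBoundedUnder_ge_plaquetteFluxEnergyPerSite t' U δ p q).isCoboundedUnder_le
      (Eventually.of_forall fun k => le_of_abs_le (abs_plaquetteFluxEnergyPerSite_le t' U δ p q k))

/-- **The energies are even in the flux along the progression** (Byers–Yang): `E_k(−p) = E_k(p)`.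
[cite: ByersYang1961] -/
theorem plaquetteFluxEnergyPerSite_neg (k : ℕ) :
    plaquetteFluxEnergyPerSite t' U δ (-p) q k = plaquetteFluxEnergyPerSite t' U δ p q k := by
  unfold plaquetteFluxEnergyPerSite
  rw [neg_mul, plaquetteFluxEnergyTT'_neg]

/-- `Inf(−p/q) = Inf(p/q)`. [cite: ByersYang1961] -/
theorem plaquetteFluxEnergyDensityInf_neg :
    plaquetteFluxEnergyDensityInf t' U δ (-p) q = plaquetteFluxEnergyDensityInf t' U δ p q := by
  unfold plaquetteFluxEnergyDensityInf
  exact congrArg (fun f : ℕ → ℝ => liminf f atTop) (funext (plaquetteFluxEnergyPerSite_neg t' U δ p q))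

/-- `Sup(−p/q) = Sup(p/q)`. [cite: ByersYang1961] -/
theorem plaquetteFluxEnergyDensitySup_neg :
    plaquetteFluxEnergyDensitySup t' U δ (-p) q = plaquetteFluxEnergyDensitySup t' U δ p q := by
  unfold plaquetteFluxEnergyDensitySup
  exact congrArg (fun f : ℕ → ℝ => limsup f atTop) (funext (plaquetteFluxEnergyPerSite_neg t' U δ p q))

/-! ### §3 Window passage: certified rows along `q ∣ L` bound `Inf` from below and `Sup` from above -/

/-- **Certified floors pass to the lower density.** A flux-row floor in the cell's grammar — for all
`L ≥ L₀` with `q ∣ L`, `lo·L² ≤ E_L(t', U, δ; p·L/q)` — gives `lo ≤ Inf(p/q)`. Ruelle (1969) §3.3.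
[cite: Ruelle1969, §3.3] -/
theorem le_plaquetteFluxEnergyDensityInf_of_forall {lo : ℝ} {L₀ : ℕ}
    (hlo : ∀ (L : ℕ) [NeZero L], L₀ ≤ L → q ∣ L →
      lo * (L : ℝ) ^ 2 ≤ plaquetteFluxEnergyTT' L t' U δ (p * ((L / q : ℕ) : ℤ))) :
    lo ≤ plaquetteFluxEnergyDensityInf t' U δ p q := by
  have hq : 0 < q := Nat.pos_of_ne_zero (NeZero.ne q)
  refine le_liminf_of_le (isBoundedUnder_le_plaquetteFluxEnergyPerSite t' U δ p q).isCoboundedUnder_ge ?_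
  filter_upwards [eventually_ge_atTop L₀] with k hk
  unfold plaquetteFluxEnergyPerSite
  rw [le_div_iff₀ (pow_pos (side_pos q k) 2)]
  have h := hlo (q * (k + 1)) (hk.trans (le_side hq k)) (dvd_mul_right _ _)
  rwa [Nat.mul_div_cancel_left _ hq] at h

/-- **Certified caps pass to the upper density.** For all `L ≥ L₀` with `q ∣ L`,
`E_L(t', U, δ; p·L/q) ≤ hi·L²` gives `Sup(p/q) ≤ hi`. Ruelle (1969) §3.3. [cite: Ruelle1969, §3.3] -/
theorem plaquetteFluxEnergyDensitySup_le_of_forall {hi : ℝ} {L₀ : ℕ}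
    (hhi : ∀ (L : ℕ) [NeZero L], L₀ ≤ L → q ∣ L →
      plaquetteFluxEnergyTT' L t' U δ (p * ((L / q : ℕ) : ℤ)) ≤ hi * (L : ℝ) ^ 2) :
    plaquetteFluxEnergyDensitySup t' U δ p q ≤ hi := by
  have hq : 0 < q := Nat.pos_of_ne_zero (NeZero.ne q)
  refine limsup_le_of_le (isBoundedUnder_ge_plaquetteFluxEnergyPerSite t' U δ p q).isCoboundedUnder_le ?_
  filter_upwards [eventually_ge_atTop L₀] with k hk
  unfold plaquetteFluxEnergyPerSite
  rw [div_le_iff₀ (pow_pos (side_pos q k) 2)]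
  have h := hhi (q * (k + 1)) (hk.trans (le_side hq k)) (dvd_mul_right _ _)
  rwa [Nat.mul_div_cancel_left _ hq] at h

/-- A floor valid along the progression is below every cap valid along it (`lo ≤ Inf ≤ Sup ≤ hi`):
the consistency check of two certificate families at one flux. [cite: Ruelle1969, §3.3] -/
theorem le_of_fluxRows {lo hi : ℝ} {L₀ L₁ : ℕ}
    (hlo : ∀ (L : ℕ) [NeZero L], L₀ ≤ L → q ∣ L →
      lo * (L : ℝ) ^ 2 ≤ plaquetteFluxEnergyTT' L t' U δ (p * ((L / q : ℕ) : ℤ)))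
    (hhi : ∀ (L : ℕ) [NeZero L], L₁ ≤ L → q ∣ L →
      plaquetteFluxEnergyTT' L t' U δ (p * ((L / q : ℕ) : ℤ)) ≤ hi * (L : ℝ) ^ 2) :
    lo ≤ hi :=
  (le_plaquetteFluxEnergyDensityInf_of_forall t' U δ p q hlo).trans
    ((plaquetteFluxEnergyDensityInf_le_sup t' U δ p q).trans
      (plaquetteFluxEnergyDensitySup_le_of_forall t' U δ p q hhi))

/-! ### §4 Zero flux: the progression samples the field-free canonical energy density -/

/-- At `p = 0` the `k`-th energy per site is the field-free canonical energy per site of the torus of side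
`q(k+1)` (`q(k+1) ≥ 3`, `δ ≥ −1`). [cite: LiebPRL1989, proof of Theorem 1] -/
theorem plaquetteFluxEnergyPerSite_zero_eq (k : ℕ) (hk : 3 ≤ q * (k + 1)) (hδ : -1 ≤ δ) :
    plaquetteFluxEnergyPerSite t' U δ 0 q k =
      groundEnergy (hubbardTorusTT' (q * (k + 1)) 1 t' U) (rectN (1 - δ) (q * (k + 1))) /
        (((q * (k + 1) : ℕ) : ℝ)) ^ 2 := by
  unfold plaquetteFluxEnergyPerSite
  rw [zero_mul, plaquetteFluxEnergyTT'_zero_eq_groundEnergy _ hk t' U hδ]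

/-- **At zero flux the progression converges to Ruelle's field-free energy density**
`energyDensityTT' 1 t' U (1−δ)` (`U ≥ 0`, `−1 < δ ≤ 1`): it is a subsequence of the canonical energies per
site of the square tori. [cite: Ruelle1969, §3.3] -/
theorem tendsto_plaquetteFluxEnergyPerSite_zero (hU : 0 ≤ U) (hδ1 : -1 < δ) (hδ2 : δ ≤ 1) :
    Tendsto (plaquetteFluxEnergyPerSite t' U δ 0 q) atTop (𝓝 (energyDensityTT' 1 t' U (1 - δ))) := by
  have hq : 0 < q := Nat.pos_of_ne_zero (NeZero.ne q)
  have hn0 : 0 ≤ 1 - δ := by linarith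
  have hn2 : 1 - δ < 2 := by linarith
  have hside : Tendsto (fun k : ℕ => q * (k + 1)) atTop atTop :=
    tendsto_atTop_mono (fun k => le_side hq k) tendsto_id
  refine ((tendsto_energyDensityTT'_torus 1 t' hU hn0 hn2).comp hside).congr' ?_
  filter_upwards [eventually_ge_atTop 3] with k hk
  simp only [Function.comp_apply]
  exact (plaquetteFluxEnergyPerSite_zero_eq t' U δ q k (hk.trans (le_side hq k)) hδ1.le).symm

/-- `Inf(0) = energyDensityTT' 1 t' U (1−δ)` (`U ≥ 0`, `−1 < δ ≤ 1`). [cite: Ruelle1969, §3.3] -/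
theorem plaquetteFluxEnergyDensityInf_zero (hU : 0 ≤ U) (hδ1 : -1 < δ) (hδ2 : δ ≤ 1) :
    plaquetteFluxEnergyDensityInf t' U δ 0 q = energyDensityTT' 1 t' U (1 - δ) :=
  (tendsto_plaquetteFluxEnergyPerSite_zero t' U δ q hU hδ1 hδ2).liminf_eq

/-- `Sup(0) = energyDensityTT' 1 t' U (1−δ)` (`U ≥ 0`, `−1 < δ ≤ 1`). [cite: Ruelle1969, §3.3] -/
theorem plaquetteFluxEnergyDensitySup_zero (hU : 0 ≤ U) (hδ1 : -1 < δ) (hδ2 : δ ≤ 1) :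
    plaquetteFluxEnergyDensitySup t' U δ 0 q = energyDensityTT' 1 t' U (1 - δ) :=
  (tendsto_plaquetteFluxEnergyPerSite_zero t' U δ q hU hδ1 hδ2).limsup_eq

/-! ### §5 The orbital-flux energy cost word, typed on the Hubbard torus -/

omit [NeZero q] in
/-- **Orbital-flux energy cost floor, eventual finite-volume form.** A certified flux-row floor `lo`
(all `L ≥ L₀`, `q ∣ L`) and a certified thermodynamic cap `e(0) := energyDensityTT' 1 t' U (1−δ) ≤ hi` on
the field-free density with `c ≤ lo − hi` give: EVERY large torus of the flux-`p/q` progression has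
energy density at least `e(0) + c`, i.e. `(e(0) + c)·L² ≤ E_L(t', U, δ; p·L/q)`. This is the T6 word
«flux `2πp/q` costs at least `c` per site» with no limit taken at flux `p/q`. [cite: Ruelle1969, §3.3] -/
theorem orbitalFluxCost_floor_of_rows {lo hi c : ℝ} {L₀ : ℕ}
    (hlo : ∀ (L : ℕ) [NeZero L], L₀ ≤ L → q ∣ L →
      lo * (L : ℝ) ^ 2 ≤ plaquetteFluxEnergyTT' L t' U δ (p * ((L / q : ℕ) : ℤ)))
    (hhi : energyDensityTT' 1 t' U (1 - δ) ≤ hi) (hc : c ≤ lo - hi) :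
    ∀ (L : ℕ) [NeZero L], L₀ ≤ L → q ∣ L →
      (energyDensityTT' 1 t' U (1 - δ) + c) * (L : ℝ) ^ 2 ≤
        plaquetteFluxEnergyTT' L t' U δ (p * ((L / q : ℕ) : ℤ)) := by
  intro L _ hL hqL
  have h := hlo L hL hqL
  have hL2 : 0 ≤ (L : ℝ) ^ 2 := sq_nonneg _
  have h1 : (energyDensityTT' 1 t' U (1 - δ) + c) * (L : ℝ) ^ 2 ≤ lo * (L : ℝ) ^ 2 :=
    mul_le_mul_of_nonneg_right (by linarith) hL2
  exact h1.trans h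

/-- **Orbital-flux energy cost floor, thermodynamic form**: under the same two rows,
`c ≤ Inf(p/q) − e(0)`. [cite: Ruelle1969, §3.3] -/
theorem le_plaquetteFluxEnergyDensityInf_sub_energyDensityTT'_of_rows {lo hi c : ℝ} {L₀ : ℕ}
    (hlo : ∀ (L : ℕ) [NeZero L], L₀ ≤ L → q ∣ L →
      lo * (L : ℝ) ^ 2 ≤ plaquetteFluxEnergyTT' L t' U δ (p * ((L / q : ℕ) : ℤ)))
    (hhi : energyDensityTT' 1 t' U (1 - δ) ≤ hi) (hc : c ≤ lo - hi) :
    c ≤ plaquetteFluxEnergyDensityInf t' U δ p q - energyDensityTT' 1 t' U (1 - δ) := by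
  have h := le_plaquetteFluxEnergyDensityInf_of_forall t' U δ p q hlo
  linarith

/-- **The card's reported word «orbital rigidity `K` at flux `B = 2πp/q`»**: rows as above with
`K·B² ≤ lo − hi` give `K·B² ≤ Inf(p/q) − e(0)` — a finite energy word at fixed flux, never an order
parameter. [cite: Hofstadter1976, §II] -/
theorem orbitalRigidity_of_rows {lo hi K : ℝ} {L₀ : ℕ}
    (hlo : ∀ (L : ℕ) [NeZero L], L₀ ≤ L → q ∣ L →
      lo * (L : ℝ) ^ 2 ≤ plaquetteFluxEnergyTT' L t' U δ (p * ((L / q : ℕ) : ℤ)))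
    (hhi : energyDensityTT' 1 t' U (1 - δ) ≤ hi)
    (hK : K * (2 * Real.pi * p / q) ^ 2 ≤ lo - hi) :
    K * (2 * Real.pi * p / q) ^ 2 ≤
      plaquetteFluxEnergyDensityInf t' U δ p q - energyDensityTT' 1 t' U (1 - δ) :=
  le_plaquetteFluxEnergyDensityInf_sub_energyDensityTT'_of_rows t' U δ p q hlo hhi hK

/-- **Ceiling twin** (the ABSENT-side use of the row): a certified flux-row cap `hi` (all `L ≥ L₀`,
`q ∣ L`) and a certified thermodynamic floor `lo ≤ e(0)` on the field-free density give
`Sup(p/q) − e(0) ≤ hi − lo`. [cite: Ruelle1969, §3.3] -/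
theorem plaquetteFluxEnergyDensitySup_sub_energyDensityTT'_le_of_rows {lo hi : ℝ} {L₀ : ℕ}
    (hhi : ∀ (L : ℕ) [NeZero L], L₀ ≤ L → q ∣ L →
      plaquetteFluxEnergyTT' L t' U δ (p * ((L / q : ℕ) : ℤ)) ≤ hi * (L : ℝ) ^ 2)
    (hlo : lo ≤ energyDensityTT' 1 t' U (1 - δ)) :
    plaquetteFluxEnergyDensitySup t' U δ p q - energyDensityTT' 1 t' U (1 - δ) ≤ hi - lo := by
  have h := plaquetteFluxEnergyDensitySup_le_of_forall t' U δ p q hhi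
  linarith

end Progression

end Literature.MathematicalPhysics.QuantumLattice
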